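import Mathlib
import Summits.NavierStokesRegularity.FluidComputer.AbcClassIEigenpairUniqueClassI
import Summits.NavierStokesRegularity.FluidComputer.AbcClassIIEigenpairClassical

/-!
# GROUP-B, **CLASS I** — THE CERTIFIED HOPF EIGENVALUE AS CLASSICAL EIGENPAIRS **WITH THEIR CLASS**: `u, u' ≠ 0`,
# `L u = 2πλ⋆ u`, `L u' = 2π·conj λ⋆ · u'`, `IsClassI (𝓕 u)`, `IsClassI (𝓕 u')` (profile-cert-3 g9, 2026-08-27)
HONEST FRAMING (D-0035/D-0074): not a claim about Navier–Stokes blow-up. WHAT THIS IS NOT: not NS evidence;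
MODEL lane (NS linearised about `abcFlow 1 1 1`, CLASS I — the Hopf rows T2/T4); no certificate, number or census
word moves. The class-I twin of `AbcClassIIEigenpairClassical` (instab3 g8's glue item, class-I cells are the m = 2
cells of the INERTIA-3L count: the pair `λ⋆`, `conj λ⋆`):
* `AbcClassI.isClassI_of_coordinates` — orbitwise syntheses on the class-I basis `bfam` are CLASS I;
* `classI_eigenpair_of_amc_coords` / `classI_eigenpair_conj_of_amc_coords` — the COORDINATES clause of the class-I
  end-to-end theorem ⇒ classical eigenpairs for `2πλ` AND `2π·conj λ`, each with `u ≠ 0` and `IsClassI (mFourierCoeff u)`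
  (`AbcLatticeEigenSynthesis.certifier_eigenpair_abcFlow_of_certifier_eigen` of the class-II file, character-free);
* **`classI_eigenpairs_of_nested_certificate`** — the class-I 3-B-nested row ⇒ `λ⋆`, both classical class-I eigenpairs,
  the (D7) exclusivity clause and the reality clause.
Mathlib + the files named; no new definitions. bears_on LADDER-NS N5 / Z4-a(1) (T2/T4) → N1* T6 (INERTIA-3L). [folklore].
-/

noncomputable section

open scoped BigOperators ComplexConjugate InnerProductSpace
open Finset MeasureTheory UnitAddTorus

/-! ### §1 Orbitwise syntheses on the class-I basis are class I -/

namespace Summit.NavierStokesRegularity.FluidComputer.AbcClassI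

open Literature.Analysis.FunctionSpaces Literature.Analysis.FunctionSpaces.Torus
open Literature.Analysis.FunctionSpaces.EuclideanSpace
open Literature.Analysis.FluidPDE Literature.Analysis.FluidPDE.SteadyLattice
open Summit.NavierStokesRegularity.FluidComputer.AbcClassII (Fam crossForm secOp rotR rotS sgnOrbit cube extend
  restrictTo Orbit toOrbit onormSq osupNorm cubeOrbits nbrOrbits mem_nbrOrbits mem_nbrOrbits_comm toOrbit_eq_iff
  mem_cubeOrbits onormSq_nonneg neg_mem_of_orbitClosed inner_eq_sum_extend extend_apply_of_mem
  extend_apply_of_not_mem sq_osupNorm_le_onormSq kdot_cut sum_cube_filter_eq mem_sgnOrbit_self rotR_apply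
  rotS_apply)

/-- **A family synthesised orbitwise from coordinates on the class-I basis is class I**:
`c k = Σ_a w⟨O,a⟩ • bfam ⟨O,a⟩ k` for `k` in the orbit `O`, `c 0 = 0` ⇒ `IsClassI c` (each orbit is closed
under the frequency maps of `r` and `s`, and on it `c` is the finite class-I combination `Σ_a w_a bfam ⟨O,a⟩`). -/
theorem isClassI_of_coordinates (c : Fam) (w : AbcClassI.Idx → ℂ)
    (hc : ∀ O : Orbit, ∀ k ∈ O.1, c k = ∑ a : Fin (AbcClassI.odim O), w ⟨O, a⟩ • AbcClassI.bfam ⟨O, a⟩ k)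
    (hc0 : c 0 = 0) : IsClassI c := by
  classical
  have hF : ∀ O : Orbit, IsClassI (∑ a : Fin (odim O), w ⟨O, a⟩ • bfam ⟨O, a⟩) := fun O =>
    isClassI_sum_smul_bfam Finset.univ (fun a : Fin (odim O) => (⟨O, a⟩ : Idx)) (fun a => w ⟨O, a⟩)
  have hcF : ∀ O : Orbit, ∀ k ∈ O.1, c k = (∑ a : Fin (odim O), w ⟨O, a⟩ • bfam ⟨O, a⟩) k := by
    intro O k hk
    rw [hc O k hk, sum_smul_bfam_apply]
  refine ⟨?_, ?_⟩
  · funext m; ext p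
    rw [rotR_apply]
    by_cases hm : m = 0
    · subst hm
      have e : (fun i : Fin 3 => (0 : Fin 3 → ℤ) ((finRotate 3).symm i)) = 0 := by funext i; rfl
      rw [e, hc0]
      rfl
    · obtain ⟨O, hmO⟩ : ∃ O : Orbit, m ∈ O.1 := ⟨toOrbit m hm, mem_sgnOrbit_self m⟩
      rw [hcF O _ (O.rotFreqR_mem hmO), hcF O m hmO]
      have h := congrArg (fun g : Fam => g m p) (hF O).1
      simp only [rotR_apply] at h
      exact h
  · funext m; ext p
    rw [rotS_apply]
    by_cases hm : m = 0
    · subst hm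
      have e : (fun i : Fin 3 => (![1, 1, -1] : Fin 3 → ℤ) ((Equiv.swap (1 : Fin 3) 2).symm i) *
          (0 : Fin 3 → ℤ) ((Equiv.swap (1 : Fin 3) 2).symm i)) = 0 := by
        funext i; simp
      rw [e, hc0]
      simp
    · obtain ⟨O, hmO⟩ : ∃ O : Orbit, m ∈ O.1 := ⟨toOrbit m hm, mem_sgnOrbit_self m⟩
      rw [hcF O _ (O.rotFreqS_mem hmO), hcF O m hmO]
      have h := congrArg (fun g : Fam => g m p) (hF O).2
      simp only [rotS_apply] at h
      exact h

end Summit.NavierStokesRegularity.FluidComputer.AbcClassI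

/-! ### §2 The classical class-I eigenpairs (λ⋆ AND conj λ⋆) from `amc`-coordinates, and from a 3-B-nested row -/

namespace Summit.NavierStokesRegularity.FluidComputer.AbcClassIEigenpair

open Literature.Analysis.FunctionSpaces Literature.Analysis.FunctionSpaces.Torus
open Literature.Analysis.FunctionSpaces.EuclideanSpace
open Literature.Analysis.FluidPDE Literature.Analysis.FluidPDE.SteadyLattice
open Summit.NavierStokesRegularity.FluidComputer.AbcClassI
open Summit.NavierStokesRegularity.FluidComputer.AbcClassII (Fam crossForm secOp rotR rotS sgnOrbit cube extend
  restrictTo Orbit toOrbit onormSq osupNorm cubeOrbits nbrOrbits mem_nbrOrbits mem_nbrOrbits_comm toOrbit_eq_iff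
  mem_cubeOrbits onormSq_nonneg neg_mem_of_orbitClosed inner_eq_sum_extend extend_apply_of_mem
  extend_apply_of_not_mem sq_osupNorm_le_onormSq kdot_cut sum_cube_filter_eq mem_sgnOrbit_self rotR_apply
  rotS_apply)

section Classical

variable (wf : Idx → Fam)
variable (hws : ∀ i : Idx, ∀ k ∉ i.1.1, wf i k = 0)
variable (hwt : ∀ (i : Idx) (k : Fin 3 → ℤ), ∑ j : Fin 3, ((k j : ℤ) : ℂ) * wf i k j = 0)
variable (hwI : ∀ i : Idx, IsClassI (wf i))
variable (hwon : ∀ (O : Orbit) (a b : Fin (odim O)),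
  ∑ k ∈ O.1, (inner ℂ (wf ⟨O, a⟩ k) (wf ⟨O, b⟩ k) : ℂ) = if a = b then 1 else 0)
variable (amc : Idx → Idx → ℂ)
variable (hamc : ∀ i j : Idx, amc i j =
  ∑ k ∈ i.1.1, (inner ℂ (wf i k) (Torus.lerayCoeff k (crossForm 1 1 1 (wf j) k)) : ℂ))

include hws hwt hwI hwon hamc in
/-- **The classical class-I eigenpair from `amc`-coordinates.** A non-zero `amc`-coordinate eigenvector for `λ`
with all moments finite ⇒ a classical eigenpair `(2πλ, u)` of the tree's linearised operator about
`abcFlow 1 1 1` at viscosity `1/(2πR)` with `u ≠ 0` and CLASS-I Fourier coefficients. -/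
theorem classI_eigenpair_of_amc_coords {R : ℝ} (hR : 1 ≤ R) (lam : ℂ)
    (wc : AbcClassI.Idx → ℂ) (hwc0 : wc ≠ 0)
    (hcoord : ∀ i : AbcClassI.Idx, ((-(onormSq i.1 / R) : ℝ) : ℂ) * wc i +
      ∑ j ∈ AbcClassI.nbrIdx i, amc i j * wc j = lam * wc i)
    (hwsum : ∀ s : ℕ, Summable fun i : AbcClassI.Idx => (1 + onormSq i.1) ^ s * ‖wc i‖ ^ 2) :
    ∃ u : UnitAddTorus (Fin 3) → EuclideanSpace ℂ (Fin 3),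
      Torus.LinNSResolventRel (1 / (2 * Real.pi * R)) (Torus.abcFlow 1 1 1) (2 * Real.pi * lam) u 0 ∧
        u ≠ 0 ∧ IsClassI (mFourierCoeff u) := by
  classical
  have hR0 : 0 < R := by linarith
  -- transfer to instab4's real class-I basis `bfam`
  obtain ⟨wa, -, hcoordA, hsumsA, hneA⟩ := ccoord_transfer wf hws hwt hwI hwon amc hamc lam wc hcoord
  have hwsumA : ∀ s : ℕ, Summable fun i : Idx => (1 + onormSq i.1) ^ s * ‖wa i‖ ^ 2 := fun s =>
    summable_of_cube_sums (fun i => (1 + onormSq i.1) ^ s)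
      (fun i => pow_nonneg (by linarith [onormSq_nonneg i.1]) _) wc wa
      (fun n => hsumsA n (fun O => (1 + onormSq O) ^ s)) (hwsum s)
  -- synthesis
  let cf : Fam := fun k => if hk : k = 0 then 0 else
    ∑ a : Fin (odim (toOrbit k hk)), wa ⟨toOrbit k hk, a⟩ • bfam ⟨toOrbit k hk, a⟩ k
  have hcf0 : cf 0 = 0 := by simp [cf]
  have hcf : ∀ O : Orbit, ∀ k ∈ O.1, cf k = ∑ a : Fin (odim O), wa ⟨O, a⟩ • bfam ⟨O, a⟩ k := by
    intro O k hk
    have hk0 : k ≠ 0 := O.ne_zero_of_mem hk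
    have hO : toOrbit k hk0 = O := (toOrbit_eq_iff hk0 O).mpr hk
    subst hO
    simp only [cf, dif_neg hk0]
  have hdecay : RapidDecay cf := rapidDecay_of_coordinates cf wa hcf hcf0 hwsumA
  have hct := kdot_of_coordinates cf wa hcf hcf0
  have hne : cf ≠ 0 := by
    obtain ⟨i, hi⟩ : ∃ i, wa i ≠ 0 := by
      by_contra hall
      push Not at hall
      exact hneA hwc0 (funext hall)
    exact ne_zero_of_coordinates cf wa hcf hi
  have hII : IsClassI cf := isClassI_of_coordinates cf wa hcf hcf0
  have heq := certifier_eigen_of_coordinates (R := R) lam cf wa hcf hcf0 hcoordA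
  obtain ⟨u, hu, hFu⟩ :=
    AbcLatticeEigenSynthesis.certifier_eigenpair_abcFlow_of_certifier_eigen 1 1 1 hR0 lam hdecay hct hcf0
      (fun k => heq k)
  refine ⟨u, hu, fun hu0 => hne ?_, by rw [hFu]; exact hII⟩
  rw [← hFu, hu0]
  funext k
  simp [mFourierCoeff]

include hws hwt hwI hwon hamc in
/-- **The CONJUGATE partner as a classical class-I eigenpair** (`L` is real; class I is conjugation-invariant): the same
coordinate data ⇒ a classical eigenpair `(2π·conj λ, u)` with `u ≠ 0` and CLASS-I Fourier coefficients. -/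
theorem classI_eigenpair_conj_of_amc_coords {R : ℝ} (hR : 1 ≤ R) (lam : ℂ)
    (wc : AbcClassI.Idx → ℂ) (hwc0 : wc ≠ 0)
    (hcoord : ∀ i : AbcClassI.Idx, ((-(onormSq i.1 / R) : ℝ) : ℂ) * wc i +
      ∑ j ∈ AbcClassI.nbrIdx i, amc i j * wc j = lam * wc i)
    (hwsum : ∀ s : ℕ, Summable fun i : AbcClassI.Idx => (1 + onormSq i.1) ^ s * ‖wc i‖ ^ 2) :
    ∃ u : UnitAddTorus (Fin 3) → EuclideanSpace ℂ (Fin 3),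
      Torus.LinNSResolventRel (1 / (2 * Real.pi * R)) (Torus.abcFlow 1 1 1) (2 * Real.pi * conj lam) u 0 ∧
        u ≠ 0 ∧ IsClassI (mFourierCoeff u) := by
  classical
  have hR0 : 0 < R := by linarith
  -- transfer to instab4's real class-I basis `bfam`
  obtain ⟨wa, -, hcoordA, hsumsA, hneA⟩ := ccoord_transfer wf hws hwt hwI hwon amc hamc lam wc hcoord
  have hwsumA : ∀ s : ℕ, Summable fun i : Idx => (1 + onormSq i.1) ^ s * ‖wa i‖ ^ 2 := fun s =>
    summable_of_cube_sums (fun i => (1 + onormSq i.1) ^ s)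
      (fun i => pow_nonneg (by linarith [onormSq_nonneg i.1]) _) wc wa
      (fun n => hsumsA n (fun O => (1 + onormSq O) ^ s)) (hwsum s)
  -- the conjugate coordinates solve the `amat`-equation for `conj λ` (`amat` is real), with the same moments
  have hcoordB : ∀ i : Idx, ((-(onormSq i.1 / R) : ℝ) : ℂ) * conj (wa i) +
      ∑ j ∈ nbrIdx i, ((amat i j : ℝ) : ℂ) * conj (wa j) = conj lam * conj (wa i) := by
    intro i
    have h := congrArg conj (hcoordA i)
    rw [map_add, map_mul, map_sum, map_mul, Complex.conj_ofReal] at h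
    rw [← h]
    congr 1
    exact Finset.sum_congr rfl fun j _ => by rw [map_mul, Complex.conj_ofReal]
  have hwsumB : ∀ s : ℕ, Summable fun i : Idx => (1 + onormSq i.1) ^ s * ‖conj (wa i)‖ ^ 2 := fun s =>
    (hwsumA s).congr fun i => by rw [Complex.norm_conj]
  -- synthesis
  let cf : Fam := fun k => if hk : k = 0 then 0 else
    ∑ a : Fin (odim (toOrbit k hk)), conj (wa ⟨toOrbit k hk, a⟩) • bfam ⟨toOrbit k hk, a⟩ k
  have hcf0 : cf 0 = 0 := by simp [cf]
  have hcf : ∀ O : Orbit, ∀ k ∈ O.1, cf k = ∑ a : Fin (odim O), conj (wa ⟨O, a⟩) • bfam ⟨O, a⟩ k := by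
    intro O k hk
    have hk0 : k ≠ 0 := O.ne_zero_of_mem hk
    have hO : toOrbit k hk0 = O := (toOrbit_eq_iff hk0 O).mpr hk
    subst hO
    simp only [cf, dif_neg hk0]
  have hdecay : RapidDecay cf := rapidDecay_of_coordinates cf (fun i => conj (wa i)) hcf hcf0 hwsumB
  have hct := kdot_of_coordinates cf (fun i => conj (wa i)) hcf hcf0
  have hne : cf ≠ 0 := by
    obtain ⟨i, hi⟩ : ∃ i, wa i ≠ 0 := by
      by_contra hall
      push Not at hall
      exact hneA hwc0 (funext hall)
    have hi' : conj (wa i) ≠ 0 := fun h => hi (by simpa using congrArg conj h)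
    exact ne_zero_of_coordinates cf (fun i => conj (wa i)) hcf hi'
  have hI : IsClassI cf := isClassI_of_coordinates cf (fun i => conj (wa i)) hcf hcf0
  have heq := certifier_eigen_of_coordinates (R := R) (conj lam) cf (fun i => conj (wa i)) hcf hcf0 hcoordB
  obtain ⟨u, hu, hFu⟩ :=
    AbcLatticeEigenSynthesis.certifier_eigenpair_abcFlow_of_certifier_eigen 1 1 1 hR0 (conj lam) hdecay hct hcf0
      (fun k => heq k)
  refine ⟨u, hu, fun hu0 => hne ?_, by rw [hFu]; exact hI⟩
  rw [← hFu, hu0]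
  funext k
  simp [mFourierCoeff]

include hws hwt hwI hwon hamc in
/-- **The class-I 3-B-nested row as TWO classical CLASS-I eigenpairs `(λ⋆, u)`, `(conj λ⋆, u')`** (the Hopf PAIR in the
input shape of the INERTIA-3L count): the hypotheses of the class-I `isLinNSEigenvalue_near_of_nested_certificate_of_complex_bases`
⇒ `∃ λ⋆`, `‖λ⋆ − λ̃‖ ≤ 2Mr₀`, classical solutions `u, u' ≠ 0` of `L u = 2πλ⋆ u`, `L u' = 2π conj λ⋆ · u'` about
`abcFlow 1 1 1` at `ν = 1/(2πR)` with `IsClassI (𝓕 u)`, `IsClassI (𝓕 u')`, the (D7) exclusivity of `λ⋆` among classical class-I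
eigenvalues within `(1 − 2√2M²r₀)/M`, and the REALITY clause (vacuous for the Hopf rows). -/
theorem classI_eigenpairs_of_nested_certificate {R : ℝ} (hR : 1 ≤ R) (K Kv : ℕ) (lt : ℂ)
    (vt : AbcClassI.Idx → ℂ) (hvt0 : ∀ i, i ∉ AbcClassI.cubeIdx Kv → vt i = 0)
    {r₀ nt : ℝ} (hr₀ : 0 ≤ r₀) (hnt : 0 ≤ nt)
    (hres : ∑ i ∈ AbcClassI.cubeIdx Kv ∪ (AbcClassI.cubeIdx Kv).biUnion AbcClassI.nbrIdx,
      ‖(if i ∈ AbcClassI.cubeIdx Kv then (lt - ((-(onormSq i.1 / R) : ℝ) : ℂ)) * vt i else 0) -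
        ∑ j ∈ AbcClassI.cubeIdx Kv, amc i j * vt j‖ ^ 2 ≤ r₀ ^ 2)
    (hntb : ∑ i ∈ AbcClassI.cubeIdx Kv \ AbcClassI.cubeIdx K, ‖vt i‖ ^ 2 ≤ nt ^ 2)
    (Binv : ((↥(AbcClassI.cubeIdx K) → ℂ) × ℂ) →ₗ[ℂ] ((↥(AbcClassI.cubeIdx K) → ℂ) × ℂ))
    (hBinv : ∀ (c : ↥(AbcClassI.cubeIdx K) → ℂ) (m : ℂ),
      Binv (fun i : ↥(AbcClassI.cubeIdx K) => (lt - ((-(onormSq i.1.1 / R) : ℝ) : ℂ)) * c i -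
          ∑ j : ↥(AbcClassI.cubeIdx K), amc i j * c j + m * vt i,
        ∑ i : ↥(AbcClassI.cubeIdx K), conj (vt i) * c i) = (c, m))
    {α βB βC gB : ℝ} (hα : 0 ≤ α) (hβB : 0 ≤ βB) (hβC : 0 ≤ βC) (hgB : 0 ≤ gB)
    (hαM : ∀ (c : ↥(AbcClassI.cubeIdx K) → ℂ) (g : ℂ),
      ∑ j : ↥(AbcClassI.cubeIdx K), ‖(Binv (c, g)).1 j‖ ^ 2 + ‖(Binv (c, g)).2‖ ^ 2 ≤
        α ^ 2 * (∑ i : ↥(AbcClassI.cubeIdx K), ‖c i‖ ^ 2 + ‖g‖ ^ 2))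
    (hβBM : ∀ e : AbcClassI.Idx → ℂ,
      ∑ j : ↥(AbcClassI.cubeIdx K), ‖(Binv (fun i : ↥(AbcClassI.cubeIdx K) => -∑ j ∈ AbcClassI.nbrIdx i \ AbcClassI.cubeIdx K,
          amc i j * e j, 0)).1 j‖ ^ 2 +
        ‖(Binv (fun i : ↥(AbcClassI.cubeIdx K) => -∑ j ∈ AbcClassI.nbrIdx i \ AbcClassI.cubeIdx K,
          amc i j * e j, 0)).2‖ ^ 2 ≤
        βB ^ 2 * ∑ j ∈ (AbcClassI.cubeIdx K).biUnion AbcClassI.nbrIdx \ AbcClassI.cubeIdx K, ‖e j‖ ^ 2)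
    (hβCM : ∀ (c : ↥(AbcClassI.cubeIdx K) → ℂ) (g : ℂ),
      ∑ i ∈ ((AbcClassI.cubeIdx K).biUnion AbcClassI.nbrIdx ∪ AbcClassI.cubeIdx Kv) \ AbcClassI.cubeIdx K,
        ‖-∑ j : ↥(AbcClassI.cubeIdx K), amc i j * (Binv (c, g)).1 j +
          (Binv (c, g)).2 * vt i‖ ^ 2 ≤ βC ^ 2 * (∑ i : ↥(AbcClassI.cubeIdx K), ‖c i‖ ^ 2 + ‖g‖ ^ 2))
    (hgBM : ∀ e : AbcClassI.Idx → ℂ,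
      ‖(Binv (fun i : ↥(AbcClassI.cubeIdx K) => ∑ j ∈ AbcClassI.nbrIdx i \ AbcClassI.cubeIdx K,
          amc i j * e j, 0)).2‖ ^ 2 ≤
        gB ^ 2 * ∑ j ∈ (AbcClassI.cubeIdx K).biUnion AbcClassI.nbrIdx \ AbcClassI.cubeIdx K, ‖e j‖ ^ 2)
    {MU2 μ M : ℝ}
    (hshellM : ∀ e : AbcClassI.Idx → ℂ, (∀ i ∈ AbcClassI.cubeIdx K, e i = 0) →
      MU2 * ∑ i ∈ AbcClassI.cubeIdx (K + 1) \ AbcClassI.cubeIdx K, ‖e i‖ ^ 2 ≤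
        ∑ i ∈ AbcClassI.cubeIdx (K + 1) \ AbcClassI.cubeIdx K, (lt.re - (-(onormSq i.1 / R)) - Real.sqrt 2) * ‖e i‖ ^ 2 -
        RCLike.re (∑ i ∈ (AbcClassI.cubeIdx K).biUnion AbcClassI.nbrIdx \ AbcClassI.cubeIdx K,
          conj (∑ j : ↥(AbcClassI.cubeIdx K), amc i j *
            (Binv (fun i : ↥(AbcClassI.cubeIdx K) => ∑ j ∈ AbcClassI.nbrIdx i \ AbcClassI.cubeIdx K,
              amc i j * e j, 0)).1 j) * e i))
    (htailK : MU2 ≤ lt.re + ((K : ℝ) + 2) ^ 2 / R - Real.sqrt 2)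
    (hμdef : μ = MU2 - gB * nt) (hμ : 0 < μ)
    (hMdef : M = √((1 + βC ^ 2) / μ ^ 2 + (α + βB * √(1 + βC ^ 2) / μ) ^ 2))
    (hκ : 2 * Real.sqrt 2 * M ^ 2 * r₀ < 1) :
    ∃ lam : ℂ, ‖lam - lt‖ ≤ 2 * M * r₀ ∧
      (∃ u : UnitAddTorus (Fin 3) → EuclideanSpace ℂ (Fin 3),
        Torus.LinNSResolventRel (1 / (2 * Real.pi * R)) (Torus.abcFlow 1 1 1) (2 * Real.pi * lam) u 0 ∧
          u ≠ 0 ∧ IsClassI (mFourierCoeff u)) ∧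
      (∃ u : UnitAddTorus (Fin 3) → EuclideanSpace ℂ (Fin 3),
        Torus.LinNSResolventRel (1 / (2 * Real.pi * R)) (Torus.abcFlow 1 1 1) (2 * Real.pi * conj lam) u 0 ∧
          u ≠ 0 ∧ IsClassI (mFourierCoeff u)) ∧
      (∀ (z : ℂ) (u : UnitAddTorus (Fin 3) → EuclideanSpace ℂ (Fin 3)),
        Torus.LinNSResolventRel (1 / (2 * Real.pi * R)) (Torus.abcFlow 1 1 1) (2 * Real.pi * z) u 0 → u ≠ 0 →
          IsClassI (mFourierCoeff u) → ‖z - lam‖ < (1 - 2 * Real.sqrt 2 * M ^ 2 * r₀) / M → z = lam) ∧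
      (lt.im = 0 → 2 * (2 * M * r₀) < (1 - 2 * Real.sqrt 2 * M ^ 2 * r₀) / M → lam.im = 0) := by
  obtain ⟨lam, hclose, -, hisol, hreal, wc, hwc0, hcoord, hwsum⟩ :=
    isLinNSEigenvalue_near_of_nested_certificate_of_complex_bases wf hws hwt hwI hwon amc hamc hR
      K Kv lt vt hvt0 hr₀ hnt hres hntb Binv hBinv hα hβB hβC hgB hαM hβBM hβCM hgBM hshellM htailK hμdef hμ hMdef hκ
  exact ⟨lam, hclose, classI_eigenpair_of_amc_coords wf hws hwt hwI hwon amc hamc hR lam wc hwc0 hcoord hwsum,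
    classI_eigenpair_conj_of_amc_coords wf hws hwt hwI hwon amc hamc hR lam wc hwc0 hcoord hwsum,
    fun z u hu hu0 hII hz => eq_of_classI_eigenfunction_of_isolated wf hws hwt hwI hwon amc hamc hR lam z hisol
      hu hu0 hII hz, hreal⟩

end Classical

end Summit.NavierStokesRegularity.FluidComputer.AbcClassIEigenpair

end
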